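import Literature.AlgebraicGeometry.Resolution.OrderAlongCurveGeneric
import Literature.AlgebraicGeometry.Resolution.RegularLocalOrderValuation
import Literature.AlgebraicGeometry.Resolution.RegularLocalRingsUFD
import Mathlib.RingTheory.Ideal.Height
import Mathlib.RingTheory.Ideal.KrullsHeightTheorem
import Mathlib.RingTheory.Ideal.UFD
import Mathlib.RingTheory.UniqueFactorizationDomain.Multiplicity
import HarnessLib

/-!
# Finiteness of the two-codimensional equimultiple locus (Mulay 1983, §1.2 / §4, first reduction)

Topic: `Literature/AlgebraicGeometry/Resolution`. Fourth brick of the discharge of the named fact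
`Mulay1983_codimTwoHyperplanar` (`Mulay1983Hyperplanarity.lean`); S. B. Mulay, *Equimultiplicity and
hyperplanarity*, Proc. Amer. Math. Soc. **89** (1983) 407–413 (lit key `paper:url-29aeafb0cf6c`).

Mulay 1.2 (p. 408): «Let `R` be an excellent regular domain and let `F` be a nonzero nonunit principal
ideal in `R`. Then `Π(R, F, d)` is a closed subset of `Spec(R)`. In particular, if `Π¹(R, F, d) = ∅`,
then `Π²(R, F, d)` is a finite set. (See 40.3 of [Nagata] and 34.A of [Matsumura].)» — and the first
line of the proof of the Main Theorem (p. 413): «If `E¹(R, F) ≠ ∅` then `E(R, F)` is hyperplanar.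
Hence assume `E¹(R, F) = ∅`.» Here `E¹ ≠ ∅` means `F = z^d R` for a regular parameter `z` (1.3 (c)).

We PROVE the dichotomy in the following RING-LEVEL form, for a regular local domain `R` whose
underlying ring is J-2 (e.g. excellent) and an element `g` of order `ν ≥ 1`:

* `finite_or_exists_eq_pow_mul` — any ANTICHAIN `𝓠` of primes of height `≤ 2` with `g ∈ P^ν` for all
  `P ∈ 𝓠` is FINITE, unless `g = h^ν · (unit)` with `ord h = 1` (the case `E¹ ≠ ∅`).

Proof (ours, replacing the reference to Nagata 40.3 by the tree's ring-level semicontinuity of the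
order, `exists_not_mem_forall_mul_not_mem_pow` of `OrderGenericAlongPrime.lean` + the J-2 input
`exists_not_mem_forall_isRegularLocalRing_quotient` of `OrderAlongCurveGeneric.lean`): if `𝓠` is
infinite, a Noetherian-maximal intersection `𝔓 = ⋂_{P ∈ 𝓐} P` over an infinite `𝓐 ⊆ 𝓠` is a prime
strictly below every member of `𝓐`, hence of height one, hence `𝔓 = (h)` (`R` is a UFD:
Auslander–Buchsbaum, the tree's `IsRegularLocalRing.uniqueFactorizationMonoid`); writing `g = h^m c`,
`h ∤ c`, the order of `g` along `(h)` is exactly `m`, so off some `g₀ ∉ (h)` every prime `𝔮 ⊇ (h)`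
has `g ∉ 𝔮^{m+1}`; as `g ∈ P^ν` for the infinitely many `P ∈ 𝓐 ∌ g₀`-exceptions would force
`g₀ ∈ 𝔓`, we get `m ≥ ν`, and counting orders (`ord` is a valuation on the regular local ring `R`)
gives `m = ν`, `ord h = 1`, `c` a unit.

No statement of H. Hironaka's 2017 manuscript is involved. AI formalisation; weaker than expert
review.

## References
* S. B. Mulay, *Equimultiplicity and hyperplanarity*, Proc. Amer. Math. Soc. 89 (1983) 407–413,
  1.2, 1.3 (c), §4 (proof of the Main Theorem, first reduction). [Mulay1983]
* V. Cossart, O. Piltant, J. Algebra 320 (2008), proof of Prop. 4.2 (upper semicontinuity of the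
  order) — via the tree's `OrderGenericAlongPrime.lean`. [CossartPiltant2008]
-/

noncomputable section

namespace Literature.AlgebraicGeometry.Resolution

namespace Mulay1983

open IsLocalRing

universe u

/-- **Mulay 1.2 / §4 first reduction, ring-level form.** Let `R` be a regular local domain whose
underlying ring is J-2, `g ∈ R` of order `ν ≥ 1`, and `𝓠` an antichain of prime ideals of height
`≤ 2` with `g ∈ P^ν` for every `P ∈ 𝓠` (in Mulay's notation `𝓠 ⊆ Π²(R, gR, ν)`). Then `𝓠` is finite,
or else `g = h^ν c` with `c` a unit and `ord h = 1` (i.e. `Π¹(R, gR, ν) ≠ ∅`, 1.3 (c)).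
[cite: Mulay1983, 1.2 and §4 (first reduction of the proof of the Main Theorem), pp. 408, 413] -/
theorem finite_or_exists_eq_pow_mul {R : Type u} [CommRing R] [IsDomain R] [IsLocalRing R]
    [IsRegularRing R] (hJ : IsJ2Ring R) {g : R} {ν : ℕ} (hν : ν ≠ 0)
    (hg : adicOrder g = ν) (𝓠 : Set (Ideal R)) (hprime : ∀ P ∈ 𝓠, P.IsPrime)
    (hanti : ∀ P ∈ 𝓠, ∀ P' ∈ 𝓠, P ≤ P' → P = P') (hht : ∀ P ∈ 𝓠, P.height ≤ 2)
    (hgP : ∀ P ∈ 𝓠, g ∈ P ^ ν) :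
    𝓠.Finite ∨ ∃ h c : R, IsUnit c ∧ adicOrder h = 1 ∧ g = h ^ ν * c := by
  classical
  haveI : IsNoetherianRing R := inferInstance
  haveI : IsRegularLocalRing R := IsRegularLocalRing.of_isRegularRing_of_isLocalRing R
  haveI : UniqueFactorizationMonoid R := uniqueFactorizationMonoid_of_isRegularLocalRing R ‹_›
  by_contra H
  push Not at H
  obtain ⟨hinf, hE⟩ := H
  have hg0 : g ≠ 0 := by
    intro h0
    rw [h0, (adicOrder_eq_top_iff (0 : R)).mpr rfl] at hg
    exact ENat.top_ne_coe ν hg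
  -- intersections over infinite subfamilies, and a Noetherian-maximal one
  let 𝓕 : Set (Ideal R) := {I | ∃ A ⊆ 𝓠, A.Infinite ∧ I = sInf A}
  have h𝓕 : 𝓕.Nonempty := ⟨sInf 𝓠, 𝓠, le_rfl, hinf, rfl⟩
  obtain ⟨𝔓, ⟨A₀, hA₀𝓠, hA₀inf, rfl⟩, hmax⟩ := set_has_maximal_iff_noetherian.mpr
    (inferInstance : IsNoetherian R R) 𝓕 h𝓕
  have hle : ∀ P ∈ A₀, sInf A₀ ≤ P := fun P hP => sInf_le hP
  -- `𝔓 = ⋂ A₀` is prime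
  have hne : ∃ P, P ∈ A₀ := hA₀inf.nonempty
  obtain ⟨P₁, hP₁⟩ := hne
  have h𝔓top : sInf A₀ ≠ ⊤ := fun h =>
    (hprime P₁ (hA₀𝓠 hP₁)).ne_top (top_le_iff.mp (h ▸ hle P₁ hP₁))
  have habsorb : ∀ B ⊆ A₀, B.Infinite → sInf B = sInf A₀ := by
    intro B hB hBinf
    have hge : sInf A₀ ≤ sInf B := sInf_le_sInf hB
    by_contra hne
    exact hmax (sInf B) ⟨B, hB.trans hA₀𝓠, hBinf, rfl⟩ (lt_of_le_of_ne hge (Ne.symm hne))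
  haveI h𝔓prime : (sInf A₀).IsPrime := by
    refine Ideal.isPrime_iff.mpr ⟨h𝔓top, fun {a b} hab => ?_⟩
    by_contra hcon
    push Not at hcon
    obtain ⟨ha, hb⟩ := hcon
    let Ba := {P ∈ A₀ | a ∈ P}
    let Bb := {P ∈ A₀ | b ∈ P}
    have hcover : A₀ ⊆ Ba ∪ Bb := by
      intro P hP
      haveI := hprime P (hA₀𝓠 hP)
      rcases (Ideal.IsPrime.mem_or_mem ‹P.IsPrime› (hle P hP hab)) with h | h
      · exact Or.inl ⟨hP, h⟩
      · exact Or.inr ⟨hP, h⟩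
    have hinf' : Ba.Infinite ∨ Bb.Infinite := by
      by_contra h
      push Not at h
      exact hA₀inf ((h.1.union h.2).subset hcover)
    rcases hinf' with h | h
    · apply ha
      rw [← habsorb Ba (fun P hP => hP.1) h]
      exact Submodule.mem_sInf.mpr fun P hP => hP.2
    · apply hb
      rw [← habsorb Bb (fun P hP => hP.1) h]
      exact Submodule.mem_sInf.mpr fun P hP => hP.2
  -- `𝔓 < P` for every `P ∈ A₀`
  have hlt : ∀ P ∈ A₀, sInf A₀ < P := by
    intro P hP
    refine lt_of_le_of_ne (hle P hP) fun heq => ?_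
    apply hA₀inf
    refine (Set.finite_singleton P).subset fun P' hP' => ?_
    exact (hanti P (hA₀𝓠 hP) P' (hA₀𝓠 hP') (heq ▸ hle P' hP')).symm ▸ rfl
  -- `g ∈ 𝔓`, so `𝔓 ≠ ⊥`
  have hg𝔓 : g ∈ sInf A₀ := Submodule.mem_sInf.mpr fun P hP =>
    Ideal.pow_le_self hν (hgP P (hA₀𝓠 hP))
  have h𝔓bot : sInf A₀ ≠ ⊥ := fun h => hg0 (by simpa [h] using hg𝔓)
  -- height one, hence principal
  have hht𝔓 : (sInf A₀).height = 1 := by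
    haveI := hprime P₁ (hA₀𝓠 hP₁)
    have h1 : (sInf A₀).height + 1 ≤ P₁.height := Ideal.height_add_one_le_of_lt_of_isPrime (hlt P₁ hP₁)
    have h2 : P₁.height ≤ 2 := hht P₁ (hA₀𝓠 hP₁)
    have h3 : (sInf A₀).height ≠ 0 := fun h => h𝔓bot (Ideal.height_eq_zero_iff_eq_bot.mp h)
    have h4 : (sInf A₀).height + 1 ≤ 2 := h1.trans h2
    -- `height` is an `ℕ∞`; it is `≤ 1` and `≠ 0`
    have htop : (sInf A₀).height ≠ ⊤ := by
      intro htop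
      rw [htop, top_add] at h4
      exact absurd h4 (by decide)
    obtain ⟨n, hn⟩ := ENat.ne_top_iff_exists.mp htop
    rw [← hn] at h4 h3 ⊢
    have h6 : n + 1 ≤ 2 := by exact_mod_cast h4
    have h7 : n ≠ 0 := fun h0 => h3 (by rw [h0]; rfl)
    have : n = 1 := by omega
    rw [this]; rfl
  obtain ⟨h, h𝔓h⟩ := (UniqueFactorizationMonoid.isPrincipal_of_height_eq_one hht𝔓).principal
  have h𝔓eq : sInf A₀ = Ideal.span {h} := h𝔓h
  have hh0 : h ≠ 0 := fun h0 => h𝔓bot (by rw [h𝔓eq, h0, Ideal.span_singleton_zero])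
  have hhprime : Prime h := (Ideal.span_singleton_prime hh0).mp (h𝔓eq ▸ h𝔓prime)
  -- `g = h^m c` with `h ∤ c`
  obtain ⟨m, c, hhc, hgmc⟩ := WfDvdMonoid.max_power_factor hg0 hhprime.irreducible
  -- the order of `g` along `(h)` is exactly `m`; generic order `≤ m` along `V(h)`
  have hreg := exists_not_mem_forall_isRegularLocalRing_quotient hJ (sInf A₀)
  obtain ⟨g₀, hg₀𝔓, hg₀⟩ := exists_not_mem_forall_mul_not_mem_pow (sInf A₀) (f := g) (m := m)
    ⟨1, fun h1 => h𝔓top ((Ideal.eq_top_iff_one _).mpr h1), by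
      rw [one_mul, h𝔓eq, Ideal.span_singleton_pow, Ideal.mem_span_singleton, hgmc]
      exact Dvd.intro c rfl⟩
    (by
      intro s hs hsg
      rw [h𝔓eq, Ideal.span_singleton_pow, Ideal.mem_span_singleton, hgmc, pow_succ] at hsg
      have h1 : h ∣ s * c := by
        have : h ^ m * h ∣ h ^ m * (s * c) := by
          have e : s * (h ^ m * c) = h ^ m * (s * c) := by ring
          rwa [e] at hsg
        exact (mul_dvd_mul_iff_left (pow_ne_zero m hh0)).mp this
      rcases hhprime.dvd_or_dvd h1 with h2 | h2
      · exact hs (h𝔓eq ▸ Ideal.mem_span_singleton.mpr h2)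
      · exact hhc h2)
    hreg
  -- `m ≥ ν`: otherwise `g₀` lies in every `P ∈ A₀`, hence in `𝔓`
  have hmν : ν ≤ m := by
    by_contra hlt'
    push Not at hlt'
    apply hg₀𝔓
    refine Submodule.mem_sInf.mpr fun P hP => ?_
    haveI := hprime P (hA₀𝓠 hP)
    by_contra hg₀P
    have := hg₀ P (hle P hP) hg₀P 1 (fun h1 => Ideal.IsPrime.ne_top' ((Ideal.eq_top_iff_one _).mpr h1))
    rw [one_mul] at this
    exact this (Ideal.pow_le_pow_right (Nat.succ_le_of_lt hlt') (hgP P (hA₀𝓠 hP)))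
  -- order count: `ν = m · ord h + ord c` with `ord h ≥ 1`, `m ≥ ν ≥ 1`
  have hc0 : c ≠ 0 := by rintro rfl; exact hg0 (by rw [hgmc, mul_zero])
  have hhm : h ∈ maximalIdeal R := by
    have : h ∈ sInf A₀ := h𝔓eq ▸ Ideal.mem_span_singleton_self h
    exact IsLocalRing.le_maximalIdeal (hprime P₁ (hA₀𝓠 hP₁)).ne_top (hle P₁ hP₁ this)
  obtain ⟨a, ha⟩ : ∃ a : ℕ, adicOrder h = a := ENat.ne_top_iff_exists.mp (adicOrder_ne_top hh0) |>.imp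
    fun a ha => ha.symm
  obtain ⟨b, hb⟩ : ∃ b : ℕ, adicOrder c = b := ENat.ne_top_iff_exists.mp (adicOrder_ne_top hc0) |>.imp
    fun b hb => hb.symm
  have ha1 : 1 ≤ a := by
    have : ((1 : ℕ) : ℕ∞) ≤ adicOrder h := (le_adicOrder_iff h 1).mpr (by rwa [pow_one])
    rw [ha] at this; exact_mod_cast this
  have hcount : ν = m * a + b := by
    have : adicOrder g = m * adicOrder h + adicOrder c := by
      rw [hgmc, adicOrder_mul, adicOrder_pow]
    rw [hg, ha, hb] at this
    exact_mod_cast this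
  have hνpos : 1 ≤ ν := Nat.pos_of_ne_zero hν
  have ha' : a = 1 := by nlinarith
  have hm : m = ν := by nlinarith
  have hb0 : b = 0 := by nlinarith
  -- `c` is a unit
  have hcunit : IsUnit c := by
    by_contra hcu
    have hcm : c ∈ maximalIdeal R := hcu
    have : ((1 : ℕ) : ℕ∞) ≤ adicOrder c := (le_adicOrder_iff c 1).mpr (by rwa [pow_one])
    rw [hb, hb0] at this
    exact absurd this (by decide)
  exact hE h c hcunit (by rw [ha, ha']; rfl) (by rw [hgmc, hm])

end Mulay1983

end Literature.AlgebraicGeometry.Resolution
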